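import Mathlib
import Summits.NavierStokesRegularity.NavierStokesRegularity.Theorems.TaoLadderRungThreeGappedFrontRobustBlockBehind
import Summits.NavierStokesRegularity.NavierStokesRegularity.Theorems.TaoLadderRungThreeGappedFrontRobustBlockStart
import Summits.NavierStokesRegularity.NavierStokesRegularity.Theorems.TaoLadderRungThreeGappedFrontRobustDeviation
import HarnessLib

/-!
# `GappedFrontRobust`, the (step) clause: THE EXACT FLOW'S A PRIORI ENVELOPE below the hand-over region
  (instantiation of `pseudoFlowOn_block_and_behind` for the exact step flow of a v2 gap certificate;
  helper for item stmt-NavierStokesRegularity-22114 `GappedFrontRobustV2`, STEP (5) of the K_B₂ assembly)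

HONEST FRAMING: a theorem about Tao-type MODEL lattice flows (Tao 2016 §4 Lemma 4.1 (4.5), (4.8)–(4.9) with
(4.3); §6.2 Prop. 6.3 (viii)–(ix)) in the cell vocabulary `TaoCascade.PseudoFlowOn`. Nothing here concerns
the Navier–Stokes equations; nothing is asserted about any table.

`exact_block_behind_envelope`: for a DEFECT-FREE zero-slack flow `S` on `[0, τ]` (`τ ≤ c`) from a ball start
around a tame reference state (`|z_{i,k}| ≤ C_T (1 + q^{−k})`, `w ≥ 1`), whose energies beyond `k₁` sit under
the certificate's tail envelope (`F_{i,k} ≤ K₀ r²/w(k−1)²`, i.e. H4a ∘ the epoch clause), and for thresholds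
`kb ≤ −1 < 1 ≤ kt` (`k₁ ≤ kt`) satisfying the three scalar selection conditions (behind drift, bottom flux,
top flux — discharged by `exists_kb_behind_condition'`, `exists_kb_bottom_flux`, `exists_top_shell`), the
amplitudes obey `|S_{i,n}| ≤ 2 (C_T + r)(1 + q^{−n})` for `n ≤ kb` and `|S_{i,k}| ≤ √(2 E₁)` on the front block
`kb < k ≤ kt`, `E₁ = 2 E⋆ q^{−2 kb} + 2`, where `E⋆ ≥ ½ m (2C_T + r)² q^{2kt}/(q² − 1)` bounds the block's start
energy uniformly in `kb`.
-/

noncomputable section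

-- the sub-problem namespace `Summit.NavierStokesRegularity.NavierStokesRegularity` repeats the summit name by design (D-0017)
set_option linter.dupNamespace false

namespace Summit.NavierStokesRegularity.NavierStokesRegularity.Theorems

open Set MeasureTheory intervalIntegral Literature.Analysis.FluidPDE Literature.Analysis.FluidPDE.TaoCascade

namespace GappedFrontRobust

variable {m : ℕ}
variable {τ ε₀ : ℝ} {α : Fin m → Fin m → Fin m → ℤ × ℤ × ℤ → ℝ}
  {S₀ : Fin m → ℤ → ℝ} {S F : Fin m → ℤ → ℝ → ℝ}

set_option maxHeartbeats 400000 in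
/-- **THE EXACT FLOW'S ENVELOPE BELOW THE HAND-OVER REGION.** See the module docstring.
[cite: Tao2016AveragedNS, §4 Lemma 4.1 (4.5), (4.8)–(4.9) with (4.3); §6.2 Prop. 6.3 (viii)–(ix)] -/
theorem exact_block_behind_envelope (h : PseudoFlowOn τ ε₀ α 0 0 S₀ (fun i k => (1 / 2) * S₀ i k ^ 2)
      (fun _ _ => 0) S F) (hτ : 0 < τ) (hε : 0 < ε₀) (hα : IsCancellingCoeff α)
    (hα1 : ∀ (i₁ i₂ i₃ : Fin m) (μ : ℤ × ℤ × ℤ), μ ∈ shiftSet → |α i₁ i₂ i₃ μ| ≤ 1)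
    {w : ℤ → ℝ} {z : Fin m → ℤ → ℝ} {r C_T c K₀ Estar C₁ : ℝ} {k₁ kb kt : ℤ}
    (hr : 0 < r) (hCT : 0 < C_T) (hK₀ : 0 ≤ K₀) (hτc : τ ≤ c) (hw1 : ∀ k, 1 ≤ w k)
    (hz : ∀ (i : Fin m) (k : ℤ), |z i k| ≤ C_T * (1 + (1 + ε₀) ^ (-(k : ℝ))))
    (hball : ∀ i k, w k * |S₀ i k - z i k| ≤ r)
    (henv : ∀ s ∈ Icc 0 τ, ∀ (i : Fin m) (k : ℤ), k₁ ≤ k → F i k s ≤ K₀ * r ^ 2 / w (k - 1) ^ 2)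
    (hk₁t : k₁ ≤ kt) (hkt1 : 1 ≤ kt) (hkb : kb ≤ -1)
    (hEstar : 1 / 2 * (m : ℝ) * (2 * C_T + r) ^ 2 * (1 + ε₀) ^ ((2 : ℝ) * kt) / ((1 + ε₀) ^ 2 - 1) ≤ Estar)
    (hE0 : 0 ≤ Estar) (hC₁ : 6 * (C_T + r) * (1 + ε₀) + 2 * Real.sqrt (2 * Estar + 2) ≤ C₁)
    (hdrift : ∀ n : ℤ, n ≤ kb →
      c * (2 * ((m : ℝ) * m * 4) * (1 + ε₀) ^ ((5 : ℝ) * n / 2) *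
        (C₁ * (1 + ε₀) ^ (-(n : ℝ))) * (C₁ * (1 + ε₀) ^ (-(n : ℝ)))) ≤
        (C_T + r) * (1 + (1 + ε₀) ^ (-(n : ℝ))) / 2)
    (hbot : c * ((1 : ℝ) * (1 + ε₀) ^ ((5 : ℝ) * kb / 2) * (C₁ * (1 + ε₀) ^ (-(kb : ℝ))) ^ 2 * 2 *
        (∑ i₁, ∑ i₂, ∑ i₃, |α i₁ i₂ i₃ (0, 0, 1)|)) ≤ 1 / 4)
    (htopflux : c * (4 * (1 + ε₀) ^ ((5 : ℝ) * kt / 2) * (Real.sqrt (2 * K₀) * r / w kt) *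
        (∑ i₁, ∑ i₂, ∑ i₃, |α i₁ i₂ i₃ (0, 0, 1)|)) ≤ 1 / 4) :
    (∀ (i : Fin m) (n : ℤ), n ≤ kb → ∀ t ∈ Icc 0 τ,
        |S i n t| ≤ 2 * ((C_T + r) * (1 + (1 + ε₀) ^ (-(n : ℝ))))) ∧
      (∀ t ∈ Icc 0 τ, ∀ (i : Fin m) (k : ℤ), kb + 1 ≤ k → k ≤ kt →
        |S i k t| ≤ Real.sqrt (2 * (2 * Estar * (1 + ε₀) ^ (-(2 : ℝ) * kb) + 2))) := by
  have hq : 0 < 1 + ε₀ := by linarith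
  have hq1 : 1 < 1 + ε₀ := by linarith
  set q : ℝ := 1 + ε₀ with hqdef
  have hw : ∀ k, 0 < w k := fun k => lt_of_lt_of_le one_pos (hw1 k)
  set C₀ : ℝ := ∑ i₁ : Fin m, ∑ i₂ : Fin m, ∑ i₃ : Fin m, |α i₁ i₂ i₃ (0, 0, 1)| with hC₀
  have hC₀0 : 0 ≤ C₀ := Finset.sum_nonneg fun _ _ => Finset.sum_nonneg fun _ _ =>
    Finset.sum_nonneg fun _ _ => abs_nonneg _
  -- constants
  set C_G : ℝ := C_T + r with hCG
  have hCG0 : 0 < C_G := by positivity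
  set G : ℤ → ℝ := fun k => C_G * (1 + q ^ (-(k : ℝ))) with hG
  have hG0 : ∀ k, 0 ≤ G k := fun k => by
    have := Real.rpow_pos_of_pos hq (-(k : ℝ)); positivity
  set E₁ : ℝ := 2 * Estar * q ^ (-(2 : ℝ) * kb) + 2 with hE₁
  have hE₁2 : 2 ≤ E₁ := by
    have h1 := Real.rpow_pos_of_pos hq (-(2 : ℝ) * kb)
    have : 0 ≤ 2 * Estar * q ^ (-(2 : ℝ) * kb) := by positivity
    simp only [hE₁]; linarith
  have hE₁0 : 0 < E₁ := by linarith
  have hC₁' : 6 * C_G * q + 2 * Real.sqrt (2 * Estar + 2) ≤ C₁ := by simpa only [hCG] using hC₁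
  have hC₁0 : 0 ≤ C₁ := le_trans (by positivity) hC₁'
  set Ĝ : ℤ → ℝ := fun n => C₁ * q ^ (-(n : ℝ)) with hĜ
  set Atop : ℝ := Real.sqrt (2 * K₀) * r / w kt with hAtop
  have hAtop0 : 0 ≤ Atop := by have := hw kt; positivity
  -- the block length
  obtain ⟨Lb, hLbdef⟩ : ∃ Lb : ℕ, (Lb : ℤ) = kt - kb := ⟨(kt - kb).toNat, Int.toNat_of_nonneg (by linarith)⟩
  have hLb1 : 1 ≤ Lb := by
    have : (1 : ℤ) ≤ (Lb : ℤ) := by rw [hLbdef]; linarith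
    exact_mod_cast this
  have hkbLb : kb + Lb = kt := by rw [hLbdef]; ring
  -- start bounds behind
  have hstart : ∀ (i : Fin m) (k : ℤ), k ≤ kb → |S₀ i k| ≤ G k := by
    intro i k _
    have hb := hball i k
    have hwk := hw k
    have h2 : |S₀ i k - z i k| ≤ r / w k := by
      rw [le_div_iff₀ hwk]; linarith [mul_comm (w k) |S₀ i k - z i k|]
    have h3 : r / w k ≤ r := div_le_self hr.le (hw1 k)
    have h4 := abs_sub_abs_le_abs_sub (S₀ i k) (z i k)
    have h5 := hz i k
    have h6 : 0 ≤ q ^ (-(k : ℝ)) := (Real.rpow_pos_of_pos hq _).le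
    have h7 : C_G * q ^ (-(k : ℝ)) = C_T * q ^ (-(k : ℝ)) + r * q ^ (-(k : ℝ)) := by rw [hCG]; ring
    have h8 : 0 ≤ r * q ^ (-(k : ℝ)) := mul_nonneg hr.le h6
    have h9 : C_G * (1 + q ^ (-(k : ℝ))) = C_G + C_G * q ^ (-(k : ℝ)) := by ring
    simp only [hG]
    rw [h9, h7]
    have h10 : C_T * (1 + q ^ (-(k : ℝ))) = C_T + C_T * q ^ (-(k : ℝ)) := by ring
    linarith
  -- block start energy
  have hblock0 : ∑ j ∈ Finset.range Lb, ∑ i, (fun i k => (1 / 2) * S₀ i k ^ 2) i (kb + 1 + j) ≤ E₁ / 2 := by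
    have h1 := block_start_energy_le (m := m) hε hr.le hCT.le hw1 hz hball (kb := kb) (kt := kt) (Lb := Lb)
      (by linarith) (by linarith) hEstar
    show ∑ j ∈ Finset.range Lb, ∑ i, (1 / 2) * S₀ i (kb + 1 + j) ^ 2 ≤ E₁ / 2
    have : Estar * q ^ (-(2 : ℝ) * kb) ≤ E₁ / 2 := by simp only [hE₁]; linarith
    exact h1.trans this
  -- neighbour envelope
  have hĜG : ∀ n : ℤ, n ≤ kb → ∀ k : ℤ, n - 1 ≤ k → k ≤ n + 1 → k ≤ kb → 3 * G k ≤ Ĝ n := by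
    intro n hn k hk1 _ hkb'
    have hk0 : (k : ℝ) ≤ -1 := by exact_mod_cast (hkb'.trans hkb)
    have h1 : (1 : ℝ) ≤ q ^ (-(k : ℝ)) := Real.one_le_rpow hq1.le (by linarith)
    have h2 : q ^ (-(k : ℝ)) ≤ q * q ^ (-(n : ℝ)) := by
      have : q * q ^ (-(n : ℝ)) = q ^ ((1 : ℝ) - n) := by
        rw [show (1 : ℝ) - n = 1 + (-(n : ℝ)) by ring, Real.rpow_add hq, Real.rpow_one]
      rw [this]
      exact Real.rpow_le_rpow_of_exponent_le hq1.le (by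
        have : ((n : ℝ) - 1) ≤ k := by exact_mod_cast hk1
        linarith)
    have h3 : 0 ≤ 2 * Real.sqrt (2 * Estar + 2) * q ^ (-(n : ℝ)) := by
      have := Real.rpow_pos_of_pos hq (-(n : ℝ)); positivity
    have h5 : C_G * 1 ≤ C_G * q ^ (-(k : ℝ)) := mul_le_mul_of_nonneg_left h1 hCG0.le
    have h6 : C_G * q ^ (-(k : ℝ)) ≤ C_G * (q * q ^ (-(n : ℝ))) := mul_le_mul_of_nonneg_left h2 hCG0.le
    have hqn : 0 ≤ q ^ (-(n : ℝ)) := (Real.rpow_pos_of_pos hq _).le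
    have h7 : (6 * C_G * q + 2 * Real.sqrt (2 * Estar + 2)) * q ^ (-(n : ℝ)) ≤ C₁ * q ^ (-(n : ℝ)) :=
      mul_le_mul_of_nonneg_right hC₁' hqn
    simp only [hG, hĜ]
    have e1 : 3 * (C_G * (1 + q ^ (-(k : ℝ)))) = 3 * C_G + 3 * (C_G * q ^ (-(k : ℝ))) := by ring
    have e2 : (6 * C_G * q + 2 * Real.sqrt (2 * Estar + 2)) * q ^ (-(n : ℝ)) =
        6 * (C_G * (q * q ^ (-(n : ℝ)))) + 2 * Real.sqrt (2 * Estar + 2) * q ^ (-(n : ℝ)) := by ring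
    rw [e1]
    rw [e2] at h7
    linarith
  have hĜb : 2 * Real.sqrt E₁ ≤ Ĝ kb := by
    -- √E₁ ≤ √(2E⋆+2) q^{-kb}
    have hkb0 : (kb : ℝ) ≤ -1 := by exact_mod_cast hkb
    have h1 : (1 : ℝ) ≤ q ^ (-(2 : ℝ) * kb) := Real.one_le_rpow hq1.le (by linarith)
    have h2 : E₁ ≤ (2 * Estar + 2) * (q ^ (-(kb : ℝ))) ^ 2 := by
      have hsq : (q ^ (-(kb : ℝ))) ^ 2 = q ^ (-(2 : ℝ) * kb) := by
        rw [← Real.rpow_natCast, ← Real.rpow_mul hq.le]; ring_nf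
      rw [hsq]; simp only [hE₁]; nlinarith
    have h3 : Real.sqrt E₁ ≤ Real.sqrt (2 * Estar + 2) * q ^ (-(kb : ℝ)) := by
      calc Real.sqrt E₁ ≤ Real.sqrt ((2 * Estar + 2) * (q ^ (-(kb : ℝ))) ^ 2) := Real.sqrt_le_sqrt h2
        _ = Real.sqrt (2 * Estar + 2) * q ^ (-(kb : ℝ)) := by
            rw [Real.sqrt_mul (by positivity), Real.sqrt_sq (Real.rpow_pos_of_pos hq _).le]
    have hqkb : 0 ≤ q ^ (-(kb : ℝ)) := (Real.rpow_pos_of_pos hq _).le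
    have h4 : 0 ≤ 6 * C_G * q * q ^ (-(kb : ℝ)) := by positivity
    have h7 : (6 * C_G * q + 2 * Real.sqrt (2 * Estar + 2)) * q ^ (-(kb : ℝ)) ≤ C₁ * q ^ (-(kb : ℝ)) :=
      mul_le_mul_of_nonneg_right hC₁' hqkb
    simp only [hĜ]
    have e2 : (6 * C_G * q + 2 * Real.sqrt (2 * Estar + 2)) * q ^ (-(kb : ℝ)) =
        6 * C_G * q * q ^ (-(kb : ℝ)) + 2 * (Real.sqrt (2 * Estar + 2) * q ^ (-(kb : ℝ))) := by ring
    rw [e2] at h7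
    linarith
  -- the top shell from H4a ∘ epoch
  have htop : ∀ t ∈ Icc 0 τ,
      (∀ u ∈ Icc 0 t, ∑ k ∈ Finset.range Lb, ∑ i, F i (kb + 1 + k) u ≤ 2 * E₁) →
        ∀ u ∈ Icc 0 t, ∀ i : Fin m, |S i (kb + 1 + Lb) u| ≤ Atop := by
    intro t ht _ u hu i
    have huτ : u ∈ Icc 0 τ := ⟨hu.1, hu.2.trans ht.2⟩
    have hkk : kb + 1 + (Lb : ℤ) = kt + 1 := by rw [hLbdef]; ring
    rw [hkk]
    have h1 := henv u huτ i (kt + 1) (by linarith)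
    rw [show kt + 1 - 1 = kt by ring] at h1
    have h2 := h.defect_lower i (kt + 1) u huτ
    have hwkt := hw kt
    have h3 : S i (kt + 1) u ^ 2 ≤ Atop ^ 2 := by
      simp only [hAtop]
      rw [div_pow, mul_pow, Real.sq_sqrt (by positivity)]
      rw [le_div_iff₀ (by positivity)]
      have : S i (kt + 1) u ^ 2 ≤ 2 * (K₀ * r ^ 2 / w kt ^ 2) := by linarith
      calc S i (kt + 1) u ^ 2 * w kt ^ 2 ≤ 2 * (K₀ * r ^ 2 / w kt ^ 2) * w kt ^ 2 :=
            mul_le_mul_of_nonneg_right this (sq_nonneg _)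
        _ = 2 * K₀ * r ^ 2 := by field_simp
    exact abs_le_of_sq_le_sq h3 hAtop0
  -- the behind drift condition
  have hCα : ∀ i : Fin m, ∑ i₁, ∑ i₂, ∑ μ ∈ shiftSet, |α i₁ i₂ i μ| ≤ (m : ℝ) * m * 4 :=
    fun i => sum_abs_coeff_le hα1 i
  have hCα0 : ∀ i : Fin m, 0 ≤ ∑ i₁, ∑ i₂, ∑ μ ∈ shiftSet, |α i₁ i₂ i μ| :=
    fun i => Finset.sum_nonneg fun _ _ => Finset.sum_nonneg fun _ _ => Finset.sum_nonneg fun _ _ => abs_nonneg _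
  have hcondBehind : ∀ (i : Fin m) (n : ℤ), n ≤ kb →
      τ * (2 * (∑ i₁, ∑ i₂, ∑ μ ∈ shiftSet, |α i₁ i₂ i μ|) * q ^ ((5 : ℝ) * n / 2) * Ĝ n * Ĝ n) ≤
        G n / 2 := by
    intro i n hn
    have h1 := hdrift n hn
    have hpos : 0 ≤ 2 * q ^ ((5 : ℝ) * n / 2) * Ĝ n * Ĝ n := by
      have := Real.rpow_pos_of_pos hq ((5 : ℝ) * n / 2)
      have : 0 ≤ Ĝ n := mul_nonneg hC₁0 (Real.rpow_pos_of_pos hq _).le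
      positivity
    calc τ * (2 * (∑ i₁, ∑ i₂, ∑ μ ∈ shiftSet, |α i₁ i₂ i μ|) * q ^ ((5 : ℝ) * n / 2) * Ĝ n * Ĝ n)
        = τ * (∑ i₁, ∑ i₂, ∑ μ ∈ shiftSet, |α i₁ i₂ i μ|) * (2 * q ^ ((5 : ℝ) * n / 2) * Ĝ n * Ĝ n) := by
          ring
      _ ≤ c * ((m : ℝ) * m * 4) * (2 * q ^ ((5 : ℝ) * n / 2) * Ĝ n * Ĝ n) := by
          refine mul_le_mul_of_nonneg_right ?_ hpos
          exact mul_le_mul hτc (hCα i) (hCα0 i) (by linarith)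
      _ = c * (2 * ((m : ℝ) * m * 4) * q ^ ((5 : ℝ) * n / 2) * (C₁ * q ^ (-(n : ℝ))) *
            (C₁ * q ^ (-(n : ℝ)))) := by simp only [hĜ]; ring
      _ ≤ G n / 2 := by simp only [hG]; exact h1
  have hdefBehind : ∀ (i : Fin m) (n : ℤ), n ≤ kb → ∀ t ∈ Icc 0 τ,
      ∫ u in (0 : ℝ)..t, 0 * q ^ ((2 : ℝ) * n) * Real.sqrt (F i n u) ≤ G n / 2 := by
    intro i n _ t _
    simp only [zero_mul, intervalIntegral.integral_zero]
    linarith [hG0 n]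
  -- the block flux condition
  have hcondBlock : τ * (q ^ ((5 : ℝ) * kb / 2) * Ĝ kb ^ 2 * (2 * Real.sqrt E₁) * C₀ +
      2 * q ^ ((5 : ℝ) * ((kb + Lb : ℤ) : ℝ) / 2) * Atop * C₀ * (2 * E₁)) ≤ E₁ / 2 := by
    rw [hkbLb]
    have hsqE : Real.sqrt E₁ ≤ E₁ := by
      have h1 : 1 ≤ Real.sqrt E₁ := by
        rw [show (1 : ℝ) = Real.sqrt 1 by simp]; exact Real.sqrt_le_sqrt (by linarith)
      nlinarith [Real.sq_sqrt hE₁0.le]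
    -- bottom: q^{5kb/2} Ĝ_kb² · 2 · C₀ ≤ 1/(4c)·... use hbot
    have hb : τ * (q ^ ((5 : ℝ) * kb / 2) * Ĝ kb ^ 2 * (2 * Real.sqrt E₁) * C₀) ≤ E₁ / 4 := by
      have e1 : τ * (q ^ ((5 : ℝ) * kb / 2) * Ĝ kb ^ 2 * (2 * Real.sqrt E₁) * C₀) =
          τ * ((1 : ℝ) * q ^ ((5 : ℝ) * kb / 2) * (C₁ * q ^ (-(kb : ℝ))) ^ 2 * 2 * C₀) * Real.sqrt E₁ := by
        simp only [hĜ]; ring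
      rw [e1]
      have hx0 : 0 ≤ (1 : ℝ) * q ^ ((5 : ℝ) * kb / 2) * (C₁ * q ^ (-(kb : ℝ))) ^ 2 * 2 * C₀ := by
        have := Real.rpow_pos_of_pos hq ((5 : ℝ) * kb / 2); positivity
      have h2 : τ * ((1 : ℝ) * q ^ ((5 : ℝ) * kb / 2) * (C₁ * q ^ (-(kb : ℝ))) ^ 2 * 2 * C₀) ≤ 1 / 4 :=
        le_trans (mul_le_mul_of_nonneg_right hτc hx0) hbot
      have h3 : 0 ≤ τ * ((1 : ℝ) * q ^ ((5 : ℝ) * kb / 2) * (C₁ * q ^ (-(kb : ℝ))) ^ 2 * 2 * C₀) :=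
        mul_nonneg hτ.le hx0
      calc _ ≤ 1 / 4 * Real.sqrt E₁ := mul_le_mul_of_nonneg_right h2 (Real.sqrt_nonneg _)
        _ ≤ 1 / 4 * E₁ := by linarith
        _ = E₁ / 4 := by ring
    have ht' : τ * (2 * q ^ ((5 : ℝ) * kt / 2) * Atop * C₀ * (2 * E₁)) ≤ E₁ / 4 := by
      have e1 : τ * (2 * q ^ ((5 : ℝ) * kt / 2) * Atop * C₀ * (2 * E₁)) =
          τ * (4 * q ^ ((5 : ℝ) * kt / 2) * Atop * C₀) * E₁ := by ring
      rw [e1]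
      have hx0 : 0 ≤ 4 * q ^ ((5 : ℝ) * kt / 2) * Atop * C₀ :=
        mul_nonneg (mul_nonneg (mul_nonneg (by norm_num) (Real.rpow_pos_of_pos hq _).le) hAtop0) hC₀0
      have h1 : τ * (4 * q ^ ((5 : ℝ) * kt / 2) * Atop * C₀) ≤ c * (4 * q ^ ((5 : ℝ) * kt / 2) * Atop * C₀) :=
        mul_le_mul_of_nonneg_right hτc hx0
      have htf : c * (4 * q ^ ((5 : ℝ) * kt / 2) * Atop * C₀) ≤ 1 / 4 := by
        simpa only [hAtop] using htopflux
      have h2 : τ * (4 * q ^ ((5 : ℝ) * kt / 2) * Atop * C₀) ≤ 1 / 4 := h1.trans htf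
      calc _ ≤ 1 / 4 * E₁ := mul_le_mul_of_nonneg_right h2 hE₁0.le
        _ = E₁ / 4 := by ring
    have e : ((kt : ℤ) : ℝ) = (kt : ℝ) := rfl
    linarith
  -- Lipschitz constants (qualitative)
  obtain ⟨M, hM0, hM⟩ := pseudoFlowOn_uniform_bounds h hq
  obtain ⟨Lb', hLb'0, hLb'⟩ := pseudoFlowOn_block_energy_lipschitz h hτ (kb + 1) Lb
  have hnum0 : 0 ≤ 2 * ((m : ℝ) * m * 4) * M * M := by positivity
  have hLa0 : 0 ≤ 2 * ((m : ℝ) * m * 4) * M * M / C_G := div_nonneg hnum0 hCG0.le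
  have hLb0 : 0 ≤ Lb' / E₁ := div_nonneg hLb'0 hE₁0.le
  set L : ℝ := 2 * ((m : ℝ) * m * 4) * M * M / C_G + Lb' / E₁ with hL
  have hL0 : 0 ≤ L := add_nonneg hLa0 hLb0
  have hlipBehind : ∀ (i : Fin m) (n : ℤ), n ≤ kb → ∀ s ∈ Icc 0 τ, ∀ t ∈ Icc 0 τ,
      |S i n t - S i n s| ≤ L * G n * |t - s| := by
    intro i n hn s hs t ht
    have hn0' : n ≤ 0 := by omega
    have hn0 : (n : ℝ) ≤ 0 := Int.cast_nonpos.mpr hn0'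
    have hq5 : q ^ ((5 : ℝ) * n / 2) ≤ 1 := Real.rpow_le_one_of_one_le_of_nonpos hq1.le (by linarith)
    have hq50 : 0 ≤ q ^ ((5 : ℝ) * n / 2) := (Real.rpow_pos_of_pos hq _).le
    have hbound : ∀ u ∈ Icc 0 τ, |quadTerm ε₀ α S i n u| + 0 * q ^ ((2 : ℝ) * n) * Real.sqrt (F i n u) ≤
        2 * ((m : ℝ) * m * 4) * M * M := by
      intro u hu
      have h1 := abs_quadTerm_le_of_uniform hε.le α S i n u (fun j k => (hM u hu j k).1)
      have h2 : 2 * (∑ i₁, ∑ i₂, ∑ μ ∈ shiftSet, |α i₁ i₂ i μ|) * q ^ ((5 : ℝ) * n / 2) * M * M ≤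
          2 * ((m : ℝ) * m * 4) * 1 * M * M := by
        have := hCα i; have := hCα0 i
        have hMM : 0 ≤ M * M := mul_nonneg hM0 hM0
        calc 2 * (∑ i₁, ∑ i₂, ∑ μ ∈ shiftSet, |α i₁ i₂ i μ|) * q ^ ((5 : ℝ) * n / 2) * M * M
            = 2 * ((∑ i₁, ∑ i₂, ∑ μ ∈ shiftSet, |α i₁ i₂ i μ|) * q ^ ((5 : ℝ) * n / 2)) * (M * M) := by ring
          _ ≤ 2 * (((m : ℝ) * m * 4) * 1) * (M * M) := by
              refine mul_le_mul_of_nonneg_right (mul_le_mul_of_nonneg_left ?_ (by norm_num)) hMM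
              exact mul_le_mul (hCα i) hq5 hq50 (by positivity)
          _ = 2 * ((m : ℝ) * m * 4) * 1 * M * M := by ring
      simp only [zero_mul, add_zero]
      linarith
    have h1 := pseudoFlowOn_abs_sub_le h i n hbound hs ht
    -- 2 Cmax M² ≤ L · G n  since G n ≥ C_G
    have hGn : C_G ≤ G n := by
      simp only [hG]
      have := mul_nonneg hCG0.le (Real.rpow_pos_of_pos hq (-(n : ℝ))).le
      linarith [mul_add C_G 1 (q ^ (-(n : ℝ)))]
    have h2 : 2 * ((m : ℝ) * m * 4) * M * M ≤ L * G n := by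
      have : 2 * ((m : ℝ) * m * 4) * M * M = (2 * ((m : ℝ) * m * 4) * M * M / C_G) * C_G := by
        field_simp
      rw [this]
      have h3 : 2 * ((m : ℝ) * m * 4) * M * M / C_G ≤ L := by
        simp only [hL]; linarith
      exact mul_le_mul h3 hGn hCG0.le hL0
    exact h1.trans (mul_le_mul_of_nonneg_right h2 (abs_nonneg _))
  have hlipBlock : ∀ s ∈ Icc 0 τ, ∀ t ∈ Icc 0 τ,
      |∑ k ∈ Finset.range Lb, ∑ i, F i (kb + 1 + k) t -
        ∑ k ∈ Finset.range Lb, ∑ i, F i (kb + 1 + k) s| ≤ L * E₁ * |t - s| := by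
    intro s hs t ht
    have h1 := hLb' s hs t ht
    have h2 : Lb' ≤ L * E₁ := by
      have : Lb' = (Lb' / E₁) * E₁ := by field_simp
      rw [this]
      refine mul_le_mul_of_nonneg_right ?_ hE₁0.le
      simp only [hL]; linarith
    exact h1.trans (mul_le_mul_of_nonneg_right h2 (abs_nonneg _))
  -- apply the joint bootstrap
  have key := pseudoFlowOn_block_and_behind h hτ hε hα kb Lb hLb1 (G := G) (Ĝ := Ĝ) (E₁ := E₁)
    (Atop := Atop) (L := L) hG0 hE₁0 hAtop0 hL0 hstart hblock0 hĜG hĜb htop hcondBehind hdefBehind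
    hcondBlock hlipBehind hlipBlock
  obtain ⟨hbehind, hblock⟩ := key
  refine ⟨fun i n hn t ht => ?_, fun t ht i k hk1 hk2 => ?_⟩
  · -- |S| ≤ |S - S₀| + |S₀| ≤ 2 G
    have h1 := hbehind i n hn t ht
    have h2 := hstart i n hn
    have h3 : |S i n t| ≤ |S i n t - S₀ i n| + |S₀ i n| := by
      have := abs_add_le (S i n t - S₀ i n) (S₀ i n); simpa using this
    simp only [hG, hCG] at h1 h2 ⊢
    linarith
  · -- block shell: ½ S² ≤ F ≤ block energy ≤ E₁
    have hE := hblock t ht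
    obtain ⟨j, hj⟩ : ∃ j : ℕ, (j : ℤ) = k - (kb + 1) := ⟨(k - (kb + 1)).toNat, Int.toNat_of_nonneg (by linarith)⟩
    have hjL : j < Lb := by
      have : (j : ℤ) < Lb := by rw [hj, hLbdef]; linarith
      exact_mod_cast this
    have hkj : kb + 1 + (j : ℤ) = k := by rw [hj]; ring
    have h1 : ∑ i', F i' k t ≤ ∑ k' ∈ Finset.range Lb, ∑ i', F i' (kb + 1 + k') t := by
      have := Finset.single_le_sum (f := fun k' : ℕ => ∑ i', F i' (kb + 1 + k') t)
        (fun k' _ => Finset.sum_nonneg fun i' _ => h.nonneg_F i' _ t ht) (Finset.mem_range.mpr hjL)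
      simpa only [hkj] using this
    have h2 : F i k t ≤ ∑ i', F i' k t :=
      Finset.single_le_sum (f := fun i' => F i' k t) (fun i' _ => h.nonneg_F i' _ t ht) (Finset.mem_univ i)
    have h3 := h.defect_lower i k t ht
    have h4 : S i k t ^ 2 ≤ Real.sqrt (2 * E₁) ^ 2 := by
      rw [Real.sq_sqrt (by linarith)]; linarith
    exact abs_le_of_sq_le_sq h4 (Real.sqrt_nonneg _)

end GappedFrontRobust

end Summit.NavierStokesRegularity.NavierStokesRegularity.Theorems

end
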